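import Mathlib
import HarnessLib
import Summits.ResolutionOfSingularities.ResolutionOfSingularities.Theorems.WildQuotientsWildQuotientResolutionS1aA1Root

/-!
# S1a — INSTANCE I-3 (D₄ = MT-D₄ v1.1), MOVE 1, ring level: (a′)₁, (H1) and the residual ideal for σ: x₁ ↦ x₁+x₀, x₂ ↦ x₂+x₀, x₃ ↦ x₃ + x₁·r
# (`r` arbitrary — D₄: `r = x₂(x₁−x₂)`; a1 was `r = x₂`)

[OURS · L1 W4.5c · lead-1 g13; plan-1 R-F15d (I-3 := MT-D₄ v1.1), X-CERT v1.1 §0 (S1) move 1 «(x₁:2, x₂:1; δ1) along the plane P₁ ⇒ [x₁]₂ KILLED (row x₂′ = β̃′);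
N(x₂) RESIDUAL V(x₁′, x₃(e₁ − x₃))», FRAME-STATUS rev16 §3] — NOT statements of the manuscript; counted 0; AI-level work, weaker than expert review. Crux
stmt-ResolutionOfSingularities-17941 `CyclicQuotientFourfolds`, line `s1a-logminvertex` v13 (`stub_reachLowerInFX`). Pure commutative algebra; the D₄
analogue of ✓`…S1aA1Root`, stated for a GENERAL `x₃`-row `x₃ ↦ x₃ + x₁·r` (the `x₁T`-row ✓`A1.a1_sigmaR_u'_one_sub` and K1′ ✓`A1.a1_isRegular` /
✓`A1.a1_isRegularRing_quotient` are taken by name).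

* `d4_admissible` — (a′)₁ relative to `β = 1` for the (2,1)-centre `(e⁻¹x₀, e⁻¹x₁)`; `d4_map_le`;
* ★ `d4_augmentationIdeal_sigmaR_le` — (H1): `aug σ_R ≤ (s)`;
* `d4_sigmaR_algebraMap_three_sub` — row of `x₃`: `σ_R x₃ − x₃ = x₁·r = s·(X₂·r)`;
* ★ `d4_u'_zero_mem_residual` (`X₁ = x₀T² ∈ 𝔞₁`), ★ `d4_u'_one_mul_mem_residual` (`X₂·r ∈ 𝔞₁`) — on the norm chart `N(x₁)` (`X₂` a unit) the residual is
  `V(X₁, r)`; for D₄ `V(X₁, x₂(x₁ − x₂)) = P̃₂ ∪ P̃₃` (X-CERT v1.1 §2 move 1).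
-/

set_option linter.dupNamespace false

noncomputable section

open Literature.AlgebraicGeometry.Resolution
open scoped LaurentPolynomial
open MvPolynomial
open Summit.ResolutionOfSingularities.ResolutionOfSingularities.Theorems.WildQuotientResolution.S1.CoarseChart
open Summit.ResolutionOfSingularities.ResolutionOfSingularities.Theorems.WildQuotientResolution.S1.BlowupCharts
open Summit.ResolutionOfSingularities.ResolutionOfSingularities.Theorems.WildQuotientResolution.S1.KillCert.A1

namespace Summit.ResolutionOfSingularities.ResolutionOfSingularities.Theorems.WildQuotientResolution.S1.KillCert.D4

variable {k : Type} [Field k] {A : Type} [CommRing A]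
  (σ : MvPolynomial (Fin 4) k ≃+* MvPolynomial (Fin 4) k) (hC : ∀ a : k, σ (C a) = C a)
  (h0 : σ (X 0) = X 0) (h1 : σ (X 1) = X 1 + X 0) (h2 : σ (X 2) = X 2 + X 0) (r : MvPolynomial (Fin 4) k)
  (h3 : σ (X 3) = X 3 + X 1 * r)
  (e : A ≃+* MvPolynomial (Fin 4) k) (τ : A ≃+* A) (hact : ∀ t : A, τ t = e.symm (σ (e t)))

/-! ## (a′)₁: the (2,1)-centre on `P` is admissible with `β = 1`, `δ = 1` -/

include hC h0 h1 h2 h3 hact in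
/-- **(a′)₁ for D₄'s move 1**: `y ∈ 𝒥ₙ(f, (2,1)) ⇒ τ y − y ∈ (1)·𝒥ₙ₊₁`. [OURS · L1 W4.5c · a1 move 1] -/
theorem d4_admissible : ∀ (n : ℕ) (y : A), y ∈ (weightedFiltration (e.symm ∘ ![X 0, X 1]) ![2, 1]).ideal n →
    τ y - y ∈ Ideal.span {(1 : A)} * (weightedFiltration (e.symm ∘ ![X 0, X 1]) ![2, 1]).ideal (n + 1) := by
  intro n y hy
  have hf0 : (e.symm ∘ ![X 0, X 1]) 0 = e.symm (X 0) := rfl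
  have hf1 : (e.symm ∘ ![X 0, X 1]) 1 = e.symm (X 1) := rfl
  have hw1 : (![2, 1] : Fin 2 → ℕ) 1 = 1 := rfl
  have hX0 : (e.symm ∘ ![X 0, X 1]) 0 ∈ (weightedFiltration (e.symm ∘ ![X 0, X 1]) ![2, 1]).ideal 2 := mem_weightedFiltration_ideal (e.symm ∘ ![X 0, X 1]) ![2, 1] 0
  have hX1 : (e.symm ∘ ![X 0, X 1]) 1 ∈ (weightedFiltration (e.symm ∘ ![X 0, X 1]) ![2, 1]).ideal 1 := mem_weightedFiltration_ideal (e.symm ∘ ![X 0, X 1]) ![2, 1] 1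
  have h1J : ∀ {m : ℕ} {z : A}, z ∈ (weightedFiltration (e.symm ∘ ![X 0, X 1]) ![2, 1]).ideal m → z ∈ Ideal.span {(1 : A)} * (weightedFiltration (e.symm ∘ ![X 0, X 1]) ![2, 1]).ideal m :=
    fun hz => by rw [Ideal.span_singleton_one, Ideal.top_mul]; exact hz
  have hinc0 : τ (e.symm (X 0)) - e.symm (X 0) = 0 := by rw [A1.act_symm σ e τ hact, h0, sub_self]
  have hinc1 : τ (e.symm (X 1)) - e.symm (X 1) = (e.symm ∘ ![X 0, X 1]) 0 := by rw [A1.act_symm σ e τ hact, h1, map_add, hf0]; ring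
  have hinc2 : τ (e.symm (X 2)) - e.symm (X 2) = (e.symm ∘ ![X 0, X 1]) 0 := by rw [A1.act_symm σ e τ hact, h2, map_add, hf0]; ring
  have hinc3 : τ (e.symm (X 3)) - e.symm (X 3) = (e.symm ∘ ![X 0, X 1]) 1 * e.symm r := by
    rw [A1.act_symm σ e τ hact, h3, map_add, map_mul, hf1]; ring
  have hgen : Subring.closure (e.symm '' (Set.range (C : k → MvPolynomial (Fin 4) k) ∪ Set.range (X : Fin 4 → MvPolynomial (Fin 4) k))) = ⊤ := by
    show Subring.closure ((e.symm : MvPolynomial (Fin 4) k →+* A) '' _) = ⊤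
    rw [← RingHom.map_closure, closure_range_C_union_range_X k, ← RingHom.range_eq_map]
    exact RingHom.range_eq_top.mpr e.symm.surjective
  have m0 : τ (e.symm (X 0)) - e.symm (X 0) ∈ Ideal.span {(1 : A)} * (weightedFiltration (e.symm ∘ ![X 0, X 1]) ![2, 1]).ideal 1 := by
    rw [hinc0]; exact Ideal.zero_mem _
  have m1 : τ (e.symm (X 1)) - e.symm (X 1) ∈ Ideal.span {(1 : A)} * (weightedFiltration (e.symm ∘ ![X 0, X 1]) ![2, 1]).ideal 1 := by
    rw [hinc1]; exact h1J ((weightedFiltration (e.symm ∘ ![X 0, X 1]) ![2, 1]).antitone (by norm_num : 1 ≤ 2) hX0)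
  have m2 : τ (e.symm (X 2)) - e.symm (X 2) ∈ Ideal.span {(1 : A)} * (weightedFiltration (e.symm ∘ ![X 0, X 1]) ![2, 1]).ideal 1 := by
    rw [hinc2]; exact h1J ((weightedFiltration (e.symm ∘ ![X 0, X 1]) ![2, 1]).antitone (by norm_num : 1 ≤ 2) hX0)
  have m3 : τ (e.symm (X 3)) - e.symm (X 3) ∈ Ideal.span {(1 : A)} * (weightedFiltration (e.symm ∘ ![X 0, X 1]) ![2, 1]).ideal 1 := by
    rw [hinc3]; exact h1J (Ideal.mul_mem_right _ _ hX1)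
  refine admissible_of_generators (e.symm ∘ ![X 0, X 1]) ![2, 1] τ 1 _ hgen ?_ ?_ n y hy
  · rintro _ ⟨g, hg | hg, rfl⟩
    · obtain ⟨a, rfl⟩ := hg
      rw [A1.act_symm σ e τ hact, hC, sub_self]; exact Ideal.zero_mem _
    · obtain ⟨i, rfl⟩ := hg
      fin_cases i
      exacts [m0, m1, m2, m3]
  · intro i
    fin_cases i
    · change τ ((e.symm ∘ ![X 0, X 1]) 0) - (e.symm ∘ ![X 0, X 1]) 0 ∈ _
      rw [hf0, hinc0]; exact Ideal.zero_mem _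
    · change τ ((e.symm ∘ ![X 0, X 1]) 1) - (e.symm ∘ ![X 0, X 1]) 1 ∈ Ideal.span {(1 : A)} * (weightedFiltration (e.symm ∘ ![X 0, X 1]) ![2, 1]).ideal ((![2, 1] : Fin 2 → ℕ) 1 + 1)
      rw [hf1, hinc1, hw1]; exact h1J hX0

include hC h0 h1 h2 h3 hact in
/-- **`τ`-stability of the filtration** of move 1. -/
theorem d4_map_le : ∀ n : ℕ, ((weightedFiltration (e.symm ∘ ![X 0, X 1]) ![2, 1]).ideal n).map (τ : A →+* A) ≤ (weightedFiltration (e.symm ∘ ![X 0, X 1]) ![2, 1]).ideal n :=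
  fun n => map_le_of_admissible (e.symm ∘ ![X 0, X 1]) ![2, 1] τ 1 (d4_admissible σ hC h0 h1 h2 r h3 e τ hact) n

/-! ## (H1) and the residual ideal on the cobordant algebra -/

section Residual

variable {p : ℕ} (hp : 0 < p) (hσp : ∀ x : A, (⇑τ)^[p] x = x)

include hC h0 h1 h2 h3 hact in
/-- ★ **(H1) for D₄'s move 1**: on `R^w = A[s, x₀T², x₁T]`, `aug σ_R ≤ (s)` (exceptional divisor with multiplicity 1; `β = 1`, `δ = 1`). -/
theorem d4_augmentationIdeal_sigmaR_le :
    augmentationIdeal (sigmaR τ (e.symm ∘ ![X 0, X 1]) ![2, 1] (d4_map_le σ hC h0 h1 h2 r h3 e τ hact) hp hσp) ≤ Ideal.span {cobordantAlgebra.s (e.symm ∘ ![X 0, X 1]) ![2, 1]} := by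
  have h := augmentationIdeal_sigmaR_le_span_of_admissible (e.symm ∘ ![X 0, X 1]) ![2, 1] τ (d4_map_le σ hC h0 h1 h2 r h3 e τ hact) hp hσp 1
    (d4_admissible σ hC h0 h1 h2 r h3 e τ hact)
  rwa [map_one, one_mul] at h

include hact h3 in
/-- `σ_R (x₃) − x₃ = x₁·r = (X₂·r)·s` in `R^w` (`X₂ = x₁T`, 0-indexed; for D₄ `r = x₂(x₁ − x₂)`). -/
theorem d4_sigmaR_algebraMap_three_sub :
    (hσJ : ∀ n : ℕ, ((weightedFiltration (e.symm ∘ ![X 0, X 1]) ![2, 1]).ideal n).map (τ : A →+* A) ≤ (weightedFiltration (e.symm ∘ ![X 0, X 1]) ![2, 1]).ideal n) →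
    sigmaR τ (e.symm ∘ ![X 0, X 1]) ![2, 1] hσJ hp hσp (algebraMap A _ (e.symm (X 3))) - algebraMap A _ (e.symm (X 3)) =
      cobordantAlgebra.u' (e.symm ∘ ![X 0, X 1]) ![2, 1] 1 * algebraMap A _ (e.symm r) * cobordantAlgebra.s (e.symm ∘ ![X 0, X 1]) ![2, 1] := by
  intro hσJ
  refine Subtype.ext ?_
  rw [AddSubgroupClass.coe_sub, MulMemClass.coe_mul, MulMemClass.coe_mul, sigmaR_algebraMap, cobordantAlgebra.coe_algebraMap, cobordantAlgebra.coe_algebraMap,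
    cobordantAlgebra.coe_algebraMap, cobordantAlgebra.coe_u', cobordantAlgebra.coe_s]
  change LaurentPolynomial.C (τ (e.symm (X 3))) - LaurentPolynomial.C (e.symm (X 3)) =
    LaurentPolynomial.C (e.symm (X 1)) * LaurentPolynomial.T ((1 : ℕ) : ℤ) * LaurentPolynomial.C (e.symm r) * LaurentPolynomial.T (-1)
  rw [A1.act_symm σ e τ hact, h3, map_add, map_mul, map_add, map_mul]
  have hT : LaurentPolynomial.T ((1 : ℕ) : ℤ) * LaurentPolynomial.T (-1) = (1 : A[T;T⁻¹]) := by
    rw [← LaurentPolynomial.T_add]; norm_num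
  calc LaurentPolynomial.C (e.symm (X 3)) + LaurentPolynomial.C (e.symm (X 1)) * LaurentPolynomial.C (e.symm r) - LaurentPolynomial.C (e.symm (X 3))
      = LaurentPolynomial.C (e.symm (X 1)) * LaurentPolynomial.C (e.symm r) * (LaurentPolynomial.T ((1 : ℕ) : ℤ) * LaurentPolynomial.T (-1)) := by rw [hT]; ring
    _ = _ := by ring

include hC h0 h1 h2 h3 hact in
/-- ★ **`X₁ = x₀T² ∈ 𝔞₁`**: the cover generator of weight 2 lies in the residual ideal `(aug σ_R : s)` of move 1. [OURS · L1 W4.5c · F13] -/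
theorem d4_u'_zero_mem_residual :
    cobordantAlgebra.u' (e.symm ∘ ![X 0, X 1]) ![2, 1] 0 ∈ (augmentationIdeal (sigmaR τ (e.symm ∘ ![X 0, X 1]) ![2, 1] (d4_map_le σ hC h0 h1 h2 r h3 e τ hact) hp hσp)).colon
      (Ideal.span {cobordantAlgebra.s (e.symm ∘ ![X 0, X 1]) ![2, 1]}) := by
  rw [Ideal.mem_colon_span_singleton, ← A1.a1_sigmaR_u'_one_sub σ h1 e τ hact hp hσp (d4_map_le σ hC h0 h1 h2 r h3 e τ hact)]
  exact sub_mem_augmentationIdeal _ _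

include hC h0 h1 h2 h3 hact in
/-- ★ **`X₂·r ∈ 𝔞₁`** (`X₂ = x₁T`): with ✓`d4_u'_zero_mem_residual` the residual on `N(x₁)` is `V(X₁, r)` (for D₄: `V(X₁, x₂(x₁ − x₂)) = P̃₂ ∪ P̃₃`).
[OURS · L1 W4.5c · X-CERT v1.1] -/
theorem d4_u'_one_mul_mem_residual :
    cobordantAlgebra.u' (e.symm ∘ ![X 0, X 1]) ![2, 1] 1 * algebraMap A _ (e.symm r) ∈
      (augmentationIdeal (sigmaR τ (e.symm ∘ ![X 0, X 1]) ![2, 1] (d4_map_le σ hC h0 h1 h2 r h3 e τ hact) hp hσp)).colon (Ideal.span {cobordantAlgebra.s (e.symm ∘ ![X 0, X 1]) ![2, 1]}) := by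
  rw [Ideal.mem_colon_span_singleton, ← d4_sigmaR_algebraMap_three_sub σ r h3 e τ hact hp hσp (d4_map_le σ hC h0 h1 h2 r h3 e τ hact)]
  exact sub_mem_augmentationIdeal _ _

end Residual

end Summit.ResolutionOfSingularities.ResolutionOfSingularities.Theorems.WildQuotientResolution.S1.KillCert.D4

end
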